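import Literature.Computability.Cryptography.HallgrenClassGroupTorsionWitnessYes
import Literature.Computability.Cryptography.HallgrenClassGroupTorsionWitnessTrial
import Literature.Computability.Complexity.AdaptiveFunctions
import HarnessLib

/-!
# The torsion-witness sampler relative to `TWBIT`

The classical randomized oracle machine of the `3 ∣ h(−d)` algorithm (Hallgren 2005, §4; the sampling of
norm-`a` ideals of Cohen 1993, §5.4), as an `FP^{TWBIT}` function `adFn Q X G TWBIT` on
`⟨bin d, coins⟩`: round `j` asks `⟨bin d, ⟨bin a_j, bin k_j⟩⟩` with `(a_j, k_j)` read from coin block `j`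
(`qry`, `block`, `exists_samplerQuery`), and the output is
`[d ∈ table ∨ (d₀ ≤ d ∧ some answer was YES)]` (`exists_samplerOut`). It is ONE-SIDED: for `−d`
negative fundamental with `3 ∤ h(−d)` every answer is NO (`three_dvd_classNumber_of_mem_twbLang`),
so the output is `[false]` on all coins (`sampler_no`); for `3 ∣ h(−d)`, a bright residue and `d ≥ d₀(c)`
the first `n⁷` trials hit a YES with probability `≥ 3/4` (`le_sum_card_filter_mem_twbLang`,
`le_uniformProb_pair`, `le_uniformProb_exists_block`, `large_conditions`), and the finitely many small
YES discriminants are tabulated — **`exists_sampler`**.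

## References

* S. Hallgren, *Fast quantum algorithms for computing the unit group and class group of a number
  field*, STOC 2005, §4 [Hallgren2005].
* H. Cohen, *A Course in Computational Algebraic Number Theory*, GTM 138, Springer 1993, §5.4
  [Cohen1993].
* S. Arora, B. Barak, *Computational Complexity: A Modern Approach*, CUP 2009, §1.3, §7.4.1
  [AroraBarak2009].
-/

open Finset Polynomial

namespace Literature.Computability.Cryptography.Hallgren2005

namespace TorsionWitness

open _root_.Computability Literature.Computability.Complexity Literature.Computability.Complexity.Brick
  Literature.Computability.Complexity.CodeFP Literature.Computability.Complexity.AdQuery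

/-! ### The machine -/

/-- The coin block length of a trial: `3n` bits for `a`, `kBits n` bits for `k`. [folklore] -/
def blkLen (n : ℕ) : ℕ := 3 * n + kBits n

/-- The query of a coin block: `⟨bin d, ⟨bin (1 + val(first 3n bits)), bin (val(next kBits n bits))⟩⟩`.
[cite: Hallgren2005, §4] -/
def qry (d n : ℕ) (blk : List Bool) : List Bool :=
  boolPair (encodeNat d) (boolPair (encodeNat (1 + bitsToNat (blk.take (3 * n))))
    (encodeNat (bitsToNat ((blk.drop (3 * n)).take (kBits n)))))

/-- Coin block `j`. [folklore] -/
def block (n : ℕ) (co : List Bool) (j : ℕ) : List Bool := (co.drop (j * blkLen n)).take (blkLen n)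

/-- `kBits n ≤ 5n`, so `blkLen n ≤ 8n`. [folklore] -/
theorem blkLen_le (n : ℕ) : blkLen n ≤ 8 * n := by
  rw [blkLen, kBits, TM2Pass.length_encodeNat_eq_size]
  have : n.size ≤ n := Nat.size_le.2 n.lt_two_pow_self
  omega

/-- Dropping `min k |l|` is dropping `k`. [folklore] -/
private theorem drop_min_length (l : List Bool) (k : ℕ) : l.drop (min k l.length) = l.drop k := by
  rcases le_total k l.length with h | h
  · rw [min_eq_left h]
  · rw [min_eq_right h, List.drop_length, List.drop_eq_nil_of_le h]

/-- **The query generator is in `FP`**: on `⟨z, answers⟩` with `z = ⟨x, coins⟩` it asks the query of coin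
block `#answers`. [cite: AroraBarak2009, §1.3] -/
theorem exists_samplerQuery : ∃ Q : List Bool → List Bool, Q ∈ FP ∧ ∀ z ans : List Bool,
    Q (boolPair z ans) = qry (bitsToNat (fstF z)) (fstF z).length (block (fstF z).length (sndF z) ans.length) := by
  have fstC : CodeFP strE strE fstF := of_fn fstF fstF_mem_FP fun _ => rfl
  have sndC : CodeFP strE strE sndF := of_fn sndF sndF_mem_FP fun _ => rfl
  have hx := fstC.comp fstC
  have hco := sndC.comp fstC
  have hn : CodeFP strE unE (fun w => (fstF (fstF w)).length) := strLength.comp hx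
  have hd : CodeFP strE natE (fun w => bitsToNat (fstF (fstF w))) := strVal.comp hx
  have hj : CodeFP strE unE (fun w => (sndF w).length) := strLength.comp sndC
  have hnStr : CodeFP strE strE (fun w => encodeNat (fstF (fstF w)).length) := (natOfUn.comp hn).recodeOut fun _ => rfl
  have hkB : CodeFP strE unE (fun w => kBits (fstF (fstF w)).length) :=
    ((unMulConst 5).comp (strLength.comp hnStr)).congr fun _ => rfl
  have h3n : CodeFP strE unE (fun w => 3 * (fstF (fstF w)).length) := (unMulConst 3).comp hn
  have hL : CodeFP strE unE (fun w => blkLen (fstF (fstF w)).length) := (unAdd.comp (h3n.pair hkB)).congr fun _ => rfl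
  have hjL : CodeFP strE natE (fun w => (sndF w).length * blkLen (fstF (fstF w)).length) :=
    (natMul.comp ((natOfUn.comp hj).pair (natOfUn.comp hL))).congr fun _ => rfl
  have hstart : CodeFP strE unE (fun w => min ((sndF w).length * blkLen (fstF (fstF w)).length) (sndF (fstF w)).length) :=
    unOfNatMin.comp ((strLength.comp hco).pair hjL)
  have hblk : CodeFP strE strE (fun w => block (fstF (fstF w)).length (sndF (fstF w)) (sndF w).length) :=
    (strTake.comp (hL.pair (strDrop.comp (hstart.pair hco)))).congr fun w => by
      simp only [block, drop_min_length]
  have ha : CodeFP strE natE (fun w => 1 + bitsToNat ((block (fstF (fstF w)).length (sndF (fstF w)) (sndF w).length).take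
      (3 * (fstF (fstF w)).length))) :=
    natAdd.comp ((const _ (1 : ℕ)).pair (strVal.comp (strTake.comp (h3n.pair hblk))))
  have hk : CodeFP strE natE (fun w => bitsToNat (((block (fstF (fstF w)).length (sndF (fstF w)) (sndF w).length).drop
      (3 * (fstF (fstF w)).length)).take (kBits (fstF (fstF w)).length))) :=
    strVal.comp (strTake.comp (hkB.pair (strDrop.comp (h3n.pair hblk))))
  have hq : CodeFP strE strE (fun w => qry (bitsToNat (fstF (fstF w))) (fstF (fstF w)).length
      (block (fstF (fstF w)).length (sndF (fstF w)) (sndF w).length)) :=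
    (hd.pair (ha.pair hk)).recodeOut fun _ => rfl
  obtain ⟨Q, hQ, hQeq⟩ := hq
  refine ⟨Q, hQ, fun z ans => ?_⟩
  have h := hQeq (boolPair z ans)
  simp only [strE, id, fstF_boolPair, sndF_boolPair] at h
  exact h

/-- **The output map is in `FP`**: `[d ∈ table ∨ (d₀ ≤ d ∧ some answer bit is 1)]` (some answer bit is `1`
iff the answer string has nonzero value). [cite: AroraBarak2009, §1.3] -/
theorem exists_samplerOut (tbl : List ℕ) (d₀ : ℕ) : ∃ G : List Bool → List Bool, G ∈ FP ∧ ∀ z bits : List Bool,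
    G (boolPair z bits) = [decide (bitsToNat (fstF z) ∈ tbl) || (decide (d₀ ≤ bitsToNat (fstF z)) && !decide (bitsToNat bits = 0))] := by
  have fstC : CodeFP strE strE fstF := of_fn fstF fstF_mem_FP fun _ => rfl
  have sndC : CodeFP strE strE sndF := of_fn sndF sndF_mem_FP fun _ => rfl
  have hd : CodeFP strE natE (fun w => bitsToNat (fstF (fstF w))) := strVal.comp (fstC.comp fstC)
  have htbl : CodeFP strE bitE (fun w => decide (bitsToNat (fstF (fstF w)) ∈ tbl)) :=
    (mem natE_injective).comp (hd.pair (const _ tbl))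
  have hge : CodeFP strE bitE (fun w => decide (d₀ ≤ bitsToNat (fstF (fstF w)))) := natLe.comp ((const _ d₀).pair hd)
  have hnz : CodeFP strE bitE (fun w => !decide (bitsToNat (sndF w) = 0)) :=
    (natEq.comp ((strVal.comp sndC).pair (const _ (0 : ℕ)))).not
  have hout : CodeFP strE strE (fun w => [decide (bitsToNat (fstF (fstF w)) ∈ tbl) ||
      (decide (d₀ ≤ bitsToNat (fstF (fstF w))) && !decide (bitsToNat (sndF w) = 0))]) :=
    (htbl.or (hge.and hnz)).recodeOut fun _ => rfl
  obtain ⟨G, hG, hGeq⟩ := hout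
  refine ⟨G, hG, fun z bits => ?_⟩
  have h := hGeq (boolPair z bits)
  simp only [strE, id, fstF_boolPair, sndF_boolPair] at h
  exact h

/-- `val(bits) = 0` iff no bit is `1`. [folklore] -/
private theorem bitsToNat_eq_zero_iff (l : List Bool) : bitsToNat l = 0 ↔ true ∉ l := by
  induction l with
  | nil => simp
  | cons b l ih =>
    rw [bitsToNat_cons, List.mem_cons, not_or]
    cases b <;> simp [ih]

/-- **Answer bits of index-only queries**: if the query depends only on the input and the NUMBER of
answers so far, the answer string lists the oracle bits of the queries `0, 1, …`. [folklore] -/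
theorem adBits_eq_map {Q : List Bool → List Bool} {f : List Bool → ℕ → List Bool}
    (hQ : ∀ z ans : List Bool, Q (boolPair z ans) = f z ans.length) (A : Language Bool) (z : List Bool) :
    ∀ i, adBits Q A z i = (List.range i).map fun j => A.boolIndicator (f z j)
  | 0 => rfl
  | i + 1 => by
    rw [adBits_succ, adBits_eq_map hQ A z i, hQ, List.length_map, List.length_range, List.range_succ,
      List.map_append, List.map_singleton]

section Value

variable {Q G : List Bool → List Bool} {tbl : List ℕ} {d₀ : ℕ}
  (hQ : ∀ z ans : List Bool,
    Q (boolPair z ans) = qry (bitsToNat (fstF z)) (fstF z).length (block (fstF z).length (sndF z) ans.length))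
  (hG : ∀ z bits : List Bool,
    G (boolPair z bits) = [decide (bitsToNat (fstF z) ∈ tbl) || (decide (d₀ ≤ bitsToNat (fstF z)) && !decide (bitsToNat bits = 0))])

include hQ hG in
/-- **The value of the sampler** on `⟨bin d, coins⟩`. [folklore] -/
theorem adFn_sampler (A : Language Bool) (d : ℕ) (co : List Bool) :
    adFn Q X G A (boolPair (encodeNat d) co) = [decide (d ∈ tbl) || (decide (d₀ ≤ d) &&
      !decide (bitsToNat ((List.range (boolPair (encodeNat d) co).length).map fun j =>
        A.boolIndicator (qry d (encodeNat d).length (block (encodeNat d).length co j))) = 0))] := by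
  rw [adFn_apply, eval_X, adBits_eq_map (f := fun z j => qry (bitsToNat (fstF z)) (fstF z).length
    (block (fstF z).length (sndF z) j)) hQ A, hG, fstF_boolPair, bitsToNat_encodeNat]
  simp only [sndF_boolPair]

include hQ hG in
/-- **One-sidedness**: for `−d` negative fundamental with `3 ∤ h(−d)` and `d ∉ table`, the output is
`[false]` on all coins. [cite: Hallgren2005, §4] -/
theorem sampler_no {d : ℕ} (hd : IsNegFundamentalDiscr d)
    (h3 : ¬ 3 ∣ Literature.NumberTheory.QuadraticFields.BinaryQuadraticForm.classNumber (-(d : ℤ)))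
    (htbl : d ∉ tbl) (co : List Bool) : [false] <+: adFn Q X G twbLang (boolPair (encodeNat d) co) := by
  rw [adFn_sampler hQ hG, decide_eq_false htbl, Bool.false_or]
  have h0 : bitsToNat ((List.range (boolPair (encodeNat d) co).length).map fun j =>
      twbLang.boolIndicator (qry d (encodeNat d).length (block (encodeNat d).length co j))) = 0 := by
    rw [bitsToNat_eq_zero_iff, List.mem_map]
    rintro ⟨j, -, hj⟩
    exact h3 (three_dvd_classNumber_of_mem_twbLang hd ((Set.mem_iff_boolIndicator _ _).2 hj))
  rw [h0]
  simp

include hQ hG in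
/-- **Small YES instances**: `d ∈ table` gives output `[true]`. [folklore] -/
theorem sampler_table {d : ℕ} (htbl : d ∈ tbl) (A : Language Bool) (co : List Bool) :
    [true] <+: adFn Q X G A (boolPair (encodeNat d) co) := by
  rw [adFn_sampler hQ hG, decide_eq_true htbl, Bool.true_or]

include hQ hG in
/-- **Large YES instances**: if `d₀ ≤ d` and some trial `t < |⟨bin d, coins⟩|` asks a YES query, the
output is `[true]`. [folklore] -/
theorem sampler_hit {d : ℕ} (hd₀ : d₀ ≤ d) {co : List Bool} {t : ℕ} (ht : t < (boolPair (encodeNat d) co).length)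
    (hyes : qry d (encodeNat d).length (block (encodeNat d).length co t) ∈ twbLang) :
    [true] <+: adFn Q X G twbLang (boolPair (encodeNat d) co) := by
  rw [adFn_sampler hQ hG, decide_eq_true hd₀, Bool.true_and]
  have hne : bitsToNat ((List.range (boolPair (encodeNat d) co).length).map fun j =>
      twbLang.boolIndicator (qry d (encodeNat d).length (block (encodeNat d).length co j))) ≠ 0 := by
    rw [Ne, bitsToNat_eq_zero_iff, not_not, List.mem_map]
    exact ⟨t, List.mem_range.2 ht, (Set.mem_iff_boolIndicator _ _).1 hyes⟩
  rw [decide_eq_false hne]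
  simp

end Value

/-! ### The success probability of the large YES instances -/

/-- **The trials hit a YES query with probability `≥ 3/4`** for `−d` negative fundamental, `3 ∣ h(−d)`,
a bright residue and `n = |bin d| ≥ 18`, `c·n ≥ 330`: coins of length `8n⁸`, trials `t < n⁷`.
[cite: Hallgren2005, §4] -/
theorem le_uniformProb_hit {d : ℕ} (hd : IsNegFundamentalDiscr d)
    (h3 : 3 ∣ Literature.NumberTheory.QuadraticFields.BinaryQuadraticForm.classNumber (-(d : ℤ)))
    {c : ℝ} (hc : 0 < c)
    (hbright : ∀ (K : Type) [Field K] [NumberField K], Module.finrank ℚ K = 2 →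
      NumberField.discr K = -(d : ℤ) → c / Real.log d ≤ NumberField.dedekindZeta_residue K)
    (hn : 18 ≤ (encodeNat d).length) (hcn : 330 ≤ c * (encodeNat d).length) :
    3 / 4 ≤ uniformProb (8 * (encodeNat d).length ^ 8)
      {co | ∃ t < (encodeNat d).length ^ 7,
        qry d (encodeNat d).length (block (encodeNat d).length co t) ∈ twbLang} := by
  classical
  set n := (encodeNat d).length with hn_def
  obtain ⟨hd4, hlarge, hY, hR, hRge, hT⟩ := large_conditions hc hn hcn
  have hlog : 0 < Real.log d := Real.log_pos (by exact_mod_cast (show 1 < d by omega))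
  have hsum := le_sum_card_filter_mem_twbLang hd h3 hc hbright hd4 hlarge hY hR hRge
  have hpair := le_uniformProb_pair (3 * n) (kBits n)
    (fun a k => boolPair (encodeNat d) (boolPair (encodeNat a) (encodeNat k)) ∈ twbLang)
  set p : ℝ := 2 * c * ((2 ^ (3 * n) : ℕ) : ℝ) / (3 * Real.pi * Real.log d) / 2 ^ (3 * n + kBits n) with hp
  have hp0 : 0 ≤ p := by positivity
  have hsum' : 2 * c * ((2 ^ (3 * n) : ℕ) : ℝ) / (3 * Real.pi * Real.log d) ≤
      ((∑ a ∈ Icc 1 (2 ^ (3 * n)), ((Finset.range (2 ^ kBits n)).filter fun k =>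
        boolPair (encodeNat d) (boolPair (encodeNat a) (encodeNat k)) ∈ twbLang).card : ℕ) : ℝ) := by
    exact_mod_cast hsum
  have hple : p ≤ uniformProb (blkLen n) {blk | qry d n blk ∈ twbLang} := by
    refine le_trans ?_ (le_trans hpair (le_of_eq rfl))
    exact div_le_div_of_nonneg_right hsum' (by positivity)
  have hm : n ^ 7 * blkLen n ≤ 8 * n ^ 8 := by
    have := blkLen_le n
    calc n ^ 7 * blkLen n ≤ n ^ 7 * (8 * n) := Nat.mul_le_mul_left _ this
      _ = 8 * n ^ 8 := by ring
  exact le_uniformProb_exists_block hm {blk | qry d n blk ∈ twbLang} hp0 hple (by exact_mod_cast hT)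

/-! ### The sampler -/

/-- **The one-sided sampler for `3 ∣ h(−d)` relative to `TWBIT`.** For every `c > 0` there are an
`FP^{TWBIT}` function `S` and a coin polynomial `q` such that on `⟨bin d, coins⟩`, `−d` negative
fundamental: if `3 ∤ h(−d)` the output is `[false]` on all coins; if `3 ∣ h(−d)` and the residue is
bright (`c / log d ≤ Res ζ_K`), the output is `[true]` with probability `≥ 3/4`. [cite: Hallgren2005, §4] -/
theorem exists_sampler (c : ℝ) (hc : 0 < c) :
    ∃ (S : List Bool → List Bool) (q : Polynomial ℕ), S ∈ FPRel (Oracle.ofLanguage twbLang) ∧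
      (∀ d : ℕ, IsNegFundamentalDiscr d →
        3 ∣ Literature.NumberTheory.QuadraticFields.BinaryQuadraticForm.classNumber (-(d : ℤ)) →
        (∀ (K : Type) [Field K] [NumberField K], Module.finrank ℚ K = 2 →
          NumberField.discr K = -(d : ℤ) → c / Real.log d ≤ NumberField.dedekindZeta_residue K) →
        3 / 4 ≤ uniformProb (q.eval (encodeNat d).length) {co | [true] <+: S (boolPair (encodeNat d) co)}) ∧
      (∀ d : ℕ, IsNegFundamentalDiscr d →
        ¬ 3 ∣ Literature.NumberTheory.QuadraticFields.BinaryQuadraticForm.classNumber (-(d : ℤ)) →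
        ∀ co : List Bool, [false] <+: S (boolPair (encodeNat d) co)) := by
  classical
  -- the threshold and the table of small YES instances
  set N₀ : ℕ := max 18 ⌈330 / c⌉₊ with hN₀
  set d₀ : ℕ := 2 ^ N₀ with hd₀
  set tbl : List ℕ := (List.range d₀).filter fun d =>
    decide (3 ∣ Literature.NumberTheory.QuadraticFields.BinaryQuadraticForm.classNumber (-(d : ℤ))) with htbl
  have hmem : ∀ d, d ∈ tbl ↔ d < d₀ ∧
      3 ∣ Literature.NumberTheory.QuadraticFields.BinaryQuadraticForm.classNumber (-(d : ℤ)) := fun d => by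
    rw [htbl, List.mem_filter, List.mem_range, decide_eq_true_iff]
  obtain ⟨Q, hQfp, hQ⟩ := exists_samplerQuery
  obtain ⟨G, hGfp, hG⟩ := exists_samplerOut tbl d₀
  refine ⟨adFn Q X G twbLang, 8 * X ^ 8, adFn_mem_FPRel hQfp hGfp _, fun d hd h3 hbright => ?_,
    fun d hd h3 co => sampler_no hQ hG hd h3 (fun h => h3 ((hmem d).1 h).2) co⟩
  by_cases hsmall : d < d₀
  · have hset : {co : List Bool | [true] <+: adFn Q X G twbLang (boolPair (encodeNat d) co)} = Set.univ :=
      Set.eq_univ_of_forall fun co => sampler_table hQ hG ((hmem d).2 ⟨hsmall, h3⟩) _ co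
    rw [hset, uniformProb_univ]; norm_num
  · push Not at hsmall
    -- `|bin d| ≥ N₀ + 1`
    have hnN : N₀ < (encodeNat d).length := by
      rw [TM2Pass.length_encodeNat_eq_size]
      exact Nat.lt_size.2 hsmall
    have hn18 : 18 ≤ (encodeNat d).length := le_trans (le_max_left _ _) hnN.le
    have hcn : 330 ≤ c * (encodeNat d).length := by
      have h1 : (330 / c : ℝ) ≤ ⌈330 / c⌉₊ := Nat.le_ceil _
      have h2 : (⌈330 / c⌉₊ : ℝ) ≤ (encodeNat d).length := by exact_mod_cast le_trans (le_max_right _ _) hnN.le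
      rw [div_le_iff₀ hc] at h1
      nlinarith
    have hev : (8 * X ^ 8 : Polynomial ℕ).eval (encodeNat d).length = 8 * (encodeNat d).length ^ 8 := by simp
    rw [hev]
    refine (le_uniformProb_hit hd h3 hc hbright hn18 hcn).trans
      (BlockRejection.uniformProb_mono_len fun co hco ⟨t, ht, hyes⟩ => sampler_hit hQ hG hsmall ?_ hyes)
    rw [length_boolPair, hco]
    have : (encodeNat d).length ^ 7 ≤ 8 * (encodeNat d).length ^ 8 := by
      calc (encodeNat d).length ^ 7 ≤ (encodeNat d).length ^ 8 := Nat.pow_le_pow_right (by omega) (by norm_num)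
        _ ≤ 8 * (encodeNat d).length ^ 8 := by omega
    omega

end TorsionWitness

end Literature.Computability.Cryptography.Hallgren2005
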